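import Summits.AnomalousDissipation.AnomalousDissipation.Theorems.SolenoidalFractalHomogenisationLagrangianStepVmodSSDispatch
import HarnessLib

/-!
# K1L_D (stmt-AnomalousDissipation-27980): (V_mod) flat stage, block (ss) — THE SINGLE-MODE DEFECT ESTIMATE ON GRID-ANCHORED WINDOWS
# (`ssMode_grid`: the text of `VmodFlat.SSMode_textEH e` for every exponent map `0 ≤ e(σ) ≤ min(σ/2, 1/2)`, on windows `[s,t]` whose
# start `s` is a carrier-grid time `j·(M·W.period/ν)`; `ssMode_zero`: the instance `s = 0`, the only one the Eulerian assembly consumes)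
(prover ad-sawtooth-k1loc-p1 g15; `--supports 27980`; the constants for `…VmodSSDispatch.defect_le_alw_dispatch`: the coarse/high threshold
`g₀` (six smallness conditions), `t₀ = (1/(50(2√2C²+1)))^{1/σ}` (also the `ν`-floor), `Kb = (K+1)/g₀` fed to the high-label family,
`θ′ = min 1 (8π²(lo/Λ)M·Wp·c·g₀²/(K+1)²)`, and `C₁` = the sum of the eleven regime lower bounds.)

The registered text `SSMode_textEH e` quantifies over ALL window starts `s ≥ 0`; this file proves its grid-anchored slice (extra binder
`∃ j : ℕ, s = j·(M·W.period/ν)`), which contains every instance (`s = 0`) used downstream (F-p1g14-5).  NOT a proof of the registered (ss)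
text for mid-period starts, of the stub, of K1L_D or of AD; rung F-D1.A0.
-/

set_option linter.dupNamespace false

noncomputable section

namespace Summit.AnomalousDissipation.AnomalousDissipation.Theorems.SolenoidalFractalHomogenisation.LagrangianStep.VmodGen

open Set MeasureTheory Complex UnitAddTorus
open scoped InnerProductSpace ENNReal
open Literature.Analysis Literature.Analysis.FunctionSpaces Literature.Analysis.FunctionSpaces.Torus
open Literature.Analysis.FluidPDE Literature.Analysis.FluidPDE.Torus Literature.Analysis.FluidPDE.LatticeShear
open Summit.AnomalousDissipation.AnomalousDissipation.Theorems.SolenoidalFractalHomogenisation.LagrangianStep.Sideband (slotAmp)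
open Summit.AnomalousDissipation.AnomalousDissipation.Theorems.SolenoidalFractalHomogenisation.LagrangianStep.VmodFlat (fc loT dW)

set_option maxHeartbeats 3200000 in
/-- **The single-mode defect estimate (ss) on grid-anchored windows**, for every exponent map `e` with `0 ≤ e(σ) ≤ min(σ/2, 1/2)`. -/
theorem ssMode_grid (e : ℝ → ℝ) (he : ∀ σ, 0 < σ → 0 ≤ e σ ∧ e σ ≤ σ / 2 ∧ e σ ≤ 1 / 2) :
    ∀ k (W : LatticeShear.LatticeWord k) (M : ℝ) (hM : 0 < M) (c : ℝ), 0 < c →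
    ∀ (Φ : ℝ → Torus.Visc4 (Fin 3) → Torus.Visc4 (Fin 3)) (lo hi Λ β σ C ν₀ K : ℝ),
    0 < lo → lo ≤ 1 → 1 ≤ hi → 1 < Λ → 0 ≤ β → 0 < σ → 0 ≤ C → 0 < ν₀ → ν₀ ≤ 1 → 0 < K →
    SlowVectorClauseF W M hM c Φ lo hi Λ β σ C ν₀ K →
    (∀ Kb : ℝ, 1 ≤ Kb → ∃ CK : ℝ, 1 ≤ CK ∧ ∃ cK > (0:ℝ), ∃ νh > (0:ℝ), HighLabelDecayW W M hM lo hi Λ β νh Kb CK cK) →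
    ∃ C₁ : ℝ, C ≤ C₁ ∧
    ∀ ν, ∀ hν : ν ∈ Set.Ioo 0 ν₀, ∀ n : ℕ, (⌈K / ν⌉₊ : ℝ) ≤ n → ∀ 𝔸 : Torus.Visc4 (Fin 3),
      Torus.OddSmall 𝔸 (ν * β) → (∃ lam ∈ Set.Icc (1:ℝ) Λ, Torus.NearIso 𝔸 (ν * (lo / lam)) (ν * (hi * lam))) →
      Torus.OddSmall (Φ ν ((1 / ν) • 𝔸)) β → (∃ lam ∈ Set.Icc (1:ℝ) Λ, Torus.NearIso (Φ ν ((1 / ν) • 𝔸)) (lo / lam) (hi * lam)) →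
      ∀ Tw > (0:ℝ), ∀ U T : ℝ → ℝ → (V2 →L[ℝ] V2),
        Torus.IsPropagator Tw (cellField W M hM ν hν.1 n) ((1 / (n:ℝ) ^ 2) • 𝔸) U →
        Torus.IsPropagator Tw (fun _ _ => 0) ((1 / (n:ℝ) ^ 2) • (𝔸 + (c / ν) • Φ ν ((1 / ν) • 𝔸))) T →
      ∀ s t : ℝ, 0 ≤ s → s < t → t ≤ Tw → (∃ j : ℕ, s = j * (M * W.period / ν)) →
      ∀ ℓ ∈ (Torus.freqBall (d := Fin 3) (n / 4)).erase 0, ∀ v : V2, v ∈ Torus.divFreeL2 (Fin 3) →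
        (∀ k', k' ≠ ℓ → k' ≠ -ℓ → fc v k' = 0) →
        ‖fc (U s t v - T s t v) ℓ‖
          ≤ (C₁ * (C₁ * (ν ^ e σ + ((⌈K / ν⌉₊ : ℝ) / n) ^ e σ) + (min 1 ((M * W.period / ν) / (t - s))) ^ e σ))
            * dW lo Λ c ν n (t - s) ℓ * ‖fc v ℓ‖ := by
  intro k W M hM c hc Φ lo hi Λ β σ C ν₀ K hlo _hlo1 hhi hΛ hβ hσ hC _hν₀ hν₀1 hK hV hHfam
  obtain ⟨_, heσ, he12⟩ := he σ hσ
  -- ### scalars of the clause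
  have hΛ0 : 0 < Λ := by linarith only [hΛ]
  have hhi0 : 0 ≤ hi := by linarith only [hhi]
  have hloΛ : 0 < lo / Λ := div_pos hlo hΛ0
  have hWp := PermissibleCarrier.period_pos W
  have hMW : 0 < M * W.period := mul_pos hM hWp
  have hX0 : 0 ≤ 2 * Real.sqrt 2 * C ^ 2 := by positivity
  -- ### the smallness scale `t₀` (also the `ν`-floor)
  obtain ⟨a₀, ha₀⟩ : ∃ a₀ : ℝ, a₀ = 1 / (50 * (2 * Real.sqrt 2 * C ^ 2 + 1)) := ⟨_, rfl⟩
  have ha₀0 : 0 < a₀ := by rw [ha₀]; positivity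
  have ha₀1 : a₀ ≤ 1 := by rw [ha₀, div_le_one (by positivity)]; linarith only [hX0]
  obtain ⟨t₀, ht₀⟩ : ∃ t₀ : ℝ, t₀ = a₀ ^ (1 / σ) := ⟨_, rfl⟩
  have ht₀0 : 0 < t₀ := by rw [ht₀]; exact Real.rpow_pos_of_pos ha₀0 _
  have ht₀1 : t₀ ≤ 1 := by rw [ht₀]; exact Real.rpow_le_one ha₀0.le ha₀1 (by positivity)
  have ht₀σ : t₀ ^ σ = a₀ := by rw [ht₀, ← Real.rpow_mul ha₀0.le, one_div_mul_cancel hσ.ne', Real.rpow_one]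
  have hsmallσ : ∀ x : ℝ, 0 ≤ x → x ≤ t₀ → 2 * Real.sqrt 2 * C ^ 2 * x ^ σ ≤ 1 / 50 := by
    intro x hx hxt
    have h1 : x ^ σ ≤ a₀ := (Real.rpow_le_rpow hx hxt hσ.le).trans ht₀σ.le
    have h2 := mul_le_mul_of_nonneg_left h1 hX0
    refine h2.trans ?_
    rw [ha₀, mul_one_div, div_le_div_iff₀ (by positivity) (by norm_num)]
    linarith only [hX0]
  -- ### the coarse/high threshold `g₀`
  have hA0 : 0 < (8 * Real.pi ^ 2 * (lo / Λ) * (M * W.period) * (1 + c) / K ^ 2) := by positivity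
  have hδ0 : 0 < (1 / (50 * (2 * Real.sqrt 2 * C * (hi * Λ ^ 2 / lo) + 1))) := by positivity
  have hB0 : 0 ≤ (12 * k * Real.exp (9 * (k : ℝ) ^ 2 / (2 * Real.pi ^ 4 * (lo / Λ) ^ 2 * c)) / (Real.pi ^ 2 * (lo / Λ) * K)) := by positivity
  have hBs0 : 0 ≤ (24 * (∑ j, ‖slotAmp W j‖) / (Real.pi * (lo / Λ) * K)) := by positivity
  obtain ⟨g₀, hg₀⟩ : ∃ g₀ : ℝ, g₀ = min 1 (min t₀ (min ((1 / (50 * (2 * Real.sqrt 2 * C * (hi * Λ ^ 2 / lo) + 1))) / (8 * Real.pi ^ 2 * (lo / Λ) * (M * W.period) * (1 + c) / K ^ 2))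
      (min (1 / (50 * ((12 * k * Real.exp (9 * (k : ℝ) ^ 2 / (2 * Real.pi ^ 4 * (lo / Λ) ^ 2 * c)) / (Real.pi ^ 2 * (lo / Λ) * K)) + 1))) (min (1 / (50 * ((24 * (∑ j, ‖slotAmp W j‖) / (Real.pi * (lo / Λ) * K)) + 1))) (K ^ 2 / (800 * (1 + c))))))) := ⟨_, rfl⟩
  have hg₀0 : 0 < g₀ := by rw [hg₀]; positivity
  have hg₀1 : g₀ ≤ 1 := by rw [hg₀]; exact min_le_left _ _
  have hg₀t : g₀ ≤ t₀ := by rw [hg₀]; exact (min_le_right _ _).trans (min_le_left _ _)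
  have hg₀A : g₀ ≤ (1 / (50 * (2 * Real.sqrt 2 * C * (hi * Λ ^ 2 / lo) + 1))) / (8 * Real.pi ^ 2 * (lo / Λ) * (M * W.period) * (1 + c) / K ^ 2) := by
    rw [hg₀]; exact (min_le_right _ _).trans ((min_le_right _ _).trans (min_le_left _ _))
  have hg₀B : g₀ ≤ 1 / (50 * ((12 * k * Real.exp (9 * (k : ℝ) ^ 2 / (2 * Real.pi ^ 4 * (lo / Λ) ^ 2 * c)) / (Real.pi ^ 2 * (lo / Λ) * K)) + 1)) := by
    rw [hg₀]; exact (min_le_right _ _).trans ((min_le_right _ _).trans ((min_le_right _ _).trans (min_le_left _ _)))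
  have hg₀Bs : g₀ ≤ 1 / (50 * ((24 * (∑ j, ‖slotAmp W j‖) / (Real.pi * (lo / Λ) * K)) + 1)) := by
    rw [hg₀]
    exact (min_le_right _ _).trans ((min_le_right _ _).trans ((min_le_right _ _).trans ((min_le_right _ _).trans (min_le_left _ _))))
  have hg₀d : g₀ ≤ K ^ 2 / (800 * (1 + c)) := by
    rw [hg₀]
    exact (min_le_right _ _).trans ((min_le_right _ _).trans ((min_le_right _ _).trans ((min_le_right _ _).trans (min_le_right _ _))))
  have hgσ : 2 * Real.sqrt 2 * C ^ 2 * g₀ ^ σ ≤ 1 / 50 := hsmallσ g₀ hg₀0.le hg₀t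
  have hνcσ : 2 * Real.sqrt 2 * C ^ 2 * t₀ ^ σ ≤ 1 / 50 := hsmallσ t₀ ht₀0.le le_rfl
  have hAg : (8 * Real.pi ^ 2 * (lo / Λ) * (M * W.period) * (1 + c) / K ^ 2) * g₀ ≤ (1 / (50 * (2 * Real.sqrt 2 * C * (hi * Λ ^ 2 / lo) + 1))) := by
    rw [mul_comm]; exact (le_div_iff₀ hA0).1 hg₀A
  have hBg : (12 * k * Real.exp (9 * (k : ℝ) ^ 2 / (2 * Real.pi ^ 4 * (lo / Λ) ^ 2 * c)) / (Real.pi ^ 2 * (lo / Λ) * K)) * g₀ ≤ 1 / 50 := by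
    refine (mul_le_mul_of_nonneg_left hg₀B hB0).trans ?_
    rw [mul_one_div, div_le_div_iff₀ (by positivity) (by norm_num)]; linarith only [hB0]
  have hBsg : (24 * (∑ j, ‖slotAmp W j‖) / (Real.pi * (lo / Λ) * K)) * g₀ ≤ 1 / 50 := by
    refine (mul_le_mul_of_nonneg_left hg₀Bs hBs0).trans ?_
    rw [mul_one_div, div_le_div_iff₀ (by positivity) (by norm_num)]; linarith only [hBs0]
  have hgd : 16 * (1 + c) * g₀ / K ^ 2 ≤ 1 / 50 := by
    rw [div_le_div_iff₀ (by positivity) (by norm_num)]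
    have := (le_div_iff₀ (by positivity : (0:ℝ) < 800 * (1 + c))).1 hg₀d
    linarith only [this]
  -- ### the high-label family at `Kb = (K+1)/g₀`, and `θ′`
  obtain ⟨Kb, hKb⟩ : ∃ Kb : ℝ, Kb = (K + 1) / g₀ := ⟨_, rfl⟩
  have hKb1 : 1 ≤ Kb := by rw [hKb, le_div_iff₀ hg₀0]; linarith only [hg₀1, hK]
  obtain ⟨CK, hCK, cK, hcK, νh, hνh, hH⟩ := hHfam Kb hKb1
  have hθL0 : 0 < (8 * Real.pi ^ 2 * (lo / Λ) * (M * W.period) * c * g₀ ^ 2 / (K + 1) ^ 2) := by positivity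
  obtain ⟨θ', hθ'⟩ : ∃ θ' : ℝ, θ' = min 1 (8 * Real.pi ^ 2 * (lo / Λ) * (M * W.period) * c * g₀ ^ 2 / (K + 1) ^ 2) := ⟨_, rfl⟩
  have hθ'0 : 0 < θ' := by rw [hθ']; exact lt_min one_pos hθL0
  have hθ'L : θ' ≤ (8 * Real.pi ^ 2 * (lo / Λ) * (M * W.period) * c * g₀ ^ 2 / (K + 1) ^ 2) := by rw [hθ']; exact min_le_right _ _
  -- ### the constant
  have hcG0 : 0 ≤ ((4 * Real.pi ^ 2 * c * (hi * Λ + β / 2) + 32 * Real.sqrt 2 * Λ * (∑ j, ‖slotAmp W j‖) ^ 2 / lo) * Λ / (8 * Real.pi ^ 2 * c * lo)) := by positivity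
  have hx1 : 0 ≤ 2 * ((4 * Real.pi ^ 2 * c * (hi * Λ + β / 2) + 32 * Real.sqrt 2 * Λ * (∑ j, ‖slotAmp W j‖) ^ 2 / lo) * Λ / (8 * Real.pi ^ 2 * c * lo)) / θ' := by positivity
  have hx2 : 0 ≤ 6 / νh := by positivity
  have hx3 : 0 ≤ (4 * Real.sqrt (2 * CK) / (cK * (M * W.period)) + 8 / θ') := by positivity
  have hx4 : 0 ≤ 6 / t₀ := by positivity
  have hx5 : 0 ≤ 8 * Real.sqrt 2 * (hi * Λ ^ 2 / lo) * C ^ 2 := by positivity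
  have hx6 : 0 ≤ 2 * 265 * (2 * Real.sqrt 2) * C ^ 2 := by positivity
  have hx7 : 0 ≤ 8 * Real.sqrt 2 * (hi * Λ ^ 2 / lo) * (C ^ 2 * (2 * ((K + 1) ^ 2 / (8 * Real.pi ^ 2 * (lo / Λ) * (M * W.period) * c))) ^ (σ / 2) + C) := by positivity
  have hx8 : 0 ≤ 4 * 265 * (2 * Real.sqrt 2 * C ^ 2 * ((K + 1) ^ 2 / (8 * Real.pi ^ 2 * (lo / Λ) * (M * W.period) * c)) ^ (σ / 2) + 2 * Real.sqrt 2 * C * (hi * Λ ^ 2 / lo) + (12 * k * Real.exp (9 * (k : ℝ) ^ 2 / (2 * Real.pi ^ 4 * (lo / Λ) ^ 2 * c)) / (Real.pi ^ 2 * (lo / Λ) * Real.sqrt (8 * Real.pi ^ 2 * (lo / Λ) * (M * W.period) * c)))) := by positivity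
  obtain ⟨C₁, hC₁⟩ : ∃ C₁ : ℝ, C₁ = C + 6 + 2 * ((4 * Real.pi ^ 2 * c * (hi * Λ + β / 2) + 32 * Real.sqrt 2 * Λ * (∑ j, ‖slotAmp W j‖) ^ 2 / lo) * Λ / (8 * Real.pi ^ 2 * c * lo)) + 2 * ((4 * Real.pi ^ 2 * c * (hi * Λ + β / 2) + 32 * Real.sqrt 2 * Λ * (∑ j, ‖slotAmp W j‖) ^ 2 / lo) * Λ / (8 * Real.pi ^ 2 * c * lo)) / θ' + 6 / νh + (4 * Real.sqrt (2 * CK) / (cK * (M * W.period)) + 8 / θ') + 6 / t₀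
      + 8 * Real.sqrt 2 * (hi * Λ ^ 2 / lo) * C ^ 2 + 2 * 265 * (2 * Real.sqrt 2) * C ^ 2
      + 8 * Real.sqrt 2 * (hi * Λ ^ 2 / lo) * (C ^ 2 * (2 * ((K + 1) ^ 2 / (8 * Real.pi ^ 2 * (lo / Λ) * (M * W.period) * c))) ^ (σ / 2) + C) + 4 * 265 * (2 * Real.sqrt 2 * C ^ 2 * ((K + 1) ^ 2 / (8 * Real.pi ^ 2 * (lo / Λ) * (M * W.period) * c)) ^ (σ / 2) + 2 * Real.sqrt 2 * C * (hi * Λ ^ 2 / lo) + (12 * k * Real.exp (9 * (k : ℝ) ^ 2 / (2 * Real.pi ^ 4 * (lo / Λ) ^ 2 * c)) / (Real.pi ^ 2 * (lo / Λ) * Real.sqrt (8 * Real.pi ^ 2 * (lo / Λ) * (M * W.period) * c)))) := ⟨_, rfl⟩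
  have hC₁C : C ≤ C₁ := by rw [hC₁]; linarith only [hcG0, hx1, hx2, hx3, hx4, hx5, hx6, hx7, hx8]
  have hC₁6 : 6 ≤ C₁ := by rw [hC₁]; linarith only [hC, hcG0, hx1, hx2, hx3, hx4, hx5, hx6, hx7, hx8]
  have hC₁1 : 1 ≤ C₁ := by linarith only [hC₁6]
  have hC₁G : 2 * ((4 * Real.pi ^ 2 * c * (hi * Λ + β / 2) + 32 * Real.sqrt 2 * Λ * (∑ j, ‖slotAmp W j‖) ^ 2 / lo) * Λ / (8 * Real.pi ^ 2 * c * lo)) ≤ C₁ := by rw [hC₁]; linarith only [hC, hcG0, hx1, hx2, hx3, hx4, hx5, hx6, hx7, hx8]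
  have hC₁Gθ : 2 * ((4 * Real.pi ^ 2 * c * (hi * Λ + β / 2) + 32 * Real.sqrt 2 * Λ * (∑ j, ‖slotAmp W j‖) ^ 2 / lo) * Λ / (8 * Real.pi ^ 2 * c * lo)) ≤ C₁ * θ' := by
    have h1 : 2 * ((4 * Real.pi ^ 2 * c * (hi * Λ + β / 2) + 32 * Real.sqrt 2 * Λ * (∑ j, ‖slotAmp W j‖) ^ 2 / lo) * Λ / (8 * Real.pi ^ 2 * c * lo)) / θ' ≤ C₁ := by rw [hC₁]; linarith only [hC, hcG0, hx1, hx2, hx3, hx4, hx5, hx6, hx7, hx8]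
    exact (div_le_iff₀ hθ'0).1 h1
  have hC₁h : 6 / νh ≤ C₁ := by rw [hC₁]; linarith only [hC, hcG0, hx1, hx2, hx3, hx4, hx5, hx6, hx7, hx8]
  have hC₁d : (4 * Real.sqrt (2 * CK) / (cK * (M * W.period)) + 8 / θ') ≤ C₁ := by rw [hC₁]; linarith only [hC, hcG0, hx1, hx2, hx3, hx4, hx5, hx6, hx7, hx8]
  have hC₁t : 6 / t₀ ≤ C₁ := by rw [hC₁]; linarith only [hC, hcG0, hx1, hx2, hx3, hx4, hx5, hx6, hx7, hx8]
  have hC₁sq : ∀ x : ℝ, x ≤ C₁ → x ≤ C₁ * C₁ := fun x hx => hx.trans (by nlinarith only [hC₁1])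
  have hC₁a3 : 8 * Real.sqrt 2 * (hi * Λ ^ 2 / lo) * C ^ 2 ≤ C₁ * C₁ :=
    hC₁sq _ (by rw [hC₁]; linarith only [hC, hcG0, hx1, hx2, hx3, hx4, hx5, hx6, hx7, hx8])
  have hC₁b3 : 8 * Real.sqrt 2 * (hi * Λ ^ 2 / lo) * (C ^ 2 * (2 * ((K + 1) ^ 2 / (8 * Real.pi ^ 2 * (lo / Λ) * (M * W.period) * c))) ^ (σ / 2) + C) ≤ C₁ := by
    rw [hC₁]; linarith only [hC, hcG0, hx1, hx2, hx3, hx4, hx5, hx6, hx7, hx8]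
  have hC₁a7 : 2 * 265 * (2 * Real.sqrt 2) * C ^ 2 ≤ C₁ * C₁ :=
    hC₁sq _ (by rw [hC₁]; linarith only [hC, hcG0, hx1, hx2, hx3, hx4, hx5, hx6, hx7, hx8])
  have hC₁b7 : 4 * 265 * (2 * Real.sqrt 2 * C ^ 2 * ((K + 1) ^ 2 / (8 * Real.pi ^ 2 * (lo / Λ) * (M * W.period) * c)) ^ (σ / 2) + 2 * Real.sqrt 2 * C * (hi * Λ ^ 2 / lo) + (12 * k * Real.exp (9 * (k : ℝ) ^ 2 / (2 * Real.pi ^ 4 * (lo / Λ) ^ 2 * c)) / (Real.pi ^ 2 * (lo / Λ) * Real.sqrt (8 * Real.pi ^ 2 * (lo / Λ) * (M * W.period) * c)))) ≤ C₁ := by rw [hC₁]; linarith only [hC, hcG0, hx1, hx2, hx3, hx4, hx5, hx6, hx7, hx8]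
  refine ⟨C₁, hC₁C, ?_⟩
  -- ### an instance
  intro ν hν n hn 𝔸 hodd hwin hΦo hΦw Tw _hTw U T hU hT s t hs hst htT hgridS ℓ hℓ v hv hvs
  obtain ⟨j₀, hs₀⟩ := hgridS
  exact defect_le_alw_dispatch hV hH hCK hcK hνh hlo hhi hΛ hβ hσ hC hν₀1 hK hc heσ he12 hg₀0 hg₀1 hKb hgσ ht₀0 hνcσ hAg hBg hBsg hgd
    hθ'0 hθ'L hC₁1 hC₁6 hC₁G hC₁Gθ hC₁h hC₁d hC₁t hC₁a3 hC₁b3 hC₁a7 hC₁b7 hν hn hodd hwin hΦo hΦw hU hT hs hst htT j₀ hs₀ hℓ v hv hvs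

set_option maxHeartbeats 1600000 in
/-- **The instance the Eulerian assembly consumes: windows from the start of the stage (`s = 0`).** -/
theorem ssMode_zero (e : ℝ → ℝ) (he : ∀ σ, 0 < σ → 0 ≤ e σ ∧ e σ ≤ σ / 2 ∧ e σ ≤ 1 / 2) :
    ∀ k (W : LatticeShear.LatticeWord k) (M : ℝ) (hM : 0 < M) (c : ℝ), 0 < c →
    ∀ (Φ : ℝ → Torus.Visc4 (Fin 3) → Torus.Visc4 (Fin 3)) (lo hi Λ β σ C ν₀ K : ℝ),
    0 < lo → lo ≤ 1 → 1 ≤ hi → 1 < Λ → 0 ≤ β → 0 < σ → 0 ≤ C → 0 < ν₀ → ν₀ ≤ 1 → 0 < K →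
    SlowVectorClauseF W M hM c Φ lo hi Λ β σ C ν₀ K →
    (∀ Kb : ℝ, 1 ≤ Kb → ∃ CK : ℝ, 1 ≤ CK ∧ ∃ cK > (0:ℝ), ∃ νh > (0:ℝ), HighLabelDecayW W M hM lo hi Λ β νh Kb CK cK) →
    ∃ C₁ : ℝ, C ≤ C₁ ∧
    ∀ ν, ∀ hν : ν ∈ Set.Ioo 0 ν₀, ∀ n : ℕ, (⌈K / ν⌉₊ : ℝ) ≤ n → ∀ 𝔸 : Torus.Visc4 (Fin 3),
      Torus.OddSmall 𝔸 (ν * β) → (∃ lam ∈ Set.Icc (1:ℝ) Λ, Torus.NearIso 𝔸 (ν * (lo / lam)) (ν * (hi * lam))) →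
      Torus.OddSmall (Φ ν ((1 / ν) • 𝔸)) β → (∃ lam ∈ Set.Icc (1:ℝ) Λ, Torus.NearIso (Φ ν ((1 / ν) • 𝔸)) (lo / lam) (hi * lam)) →
      ∀ Tw > (0:ℝ), ∀ U T : ℝ → ℝ → (V2 →L[ℝ] V2),
        Torus.IsPropagator Tw (cellField W M hM ν hν.1 n) ((1 / (n:ℝ) ^ 2) • 𝔸) U →
        Torus.IsPropagator Tw (fun _ _ => 0) ((1 / (n:ℝ) ^ 2) • (𝔸 + (c / ν) • Φ ν ((1 / ν) • 𝔸))) T →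
      ∀ t : ℝ, 0 < t → t ≤ Tw →
      ∀ ℓ ∈ (Torus.freqBall (d := Fin 3) (n / 4)).erase 0, ∀ v : V2, v ∈ Torus.divFreeL2 (Fin 3) →
        (∀ k', k' ≠ ℓ → k' ≠ -ℓ → fc v k' = 0) →
        ‖fc (U 0 t v - T 0 t v) ℓ‖
          ≤ (C₁ * (C₁ * (ν ^ e σ + ((⌈K / ν⌉₊ : ℝ) / n) ^ e σ) + (min 1 ((M * W.period / ν) / t)) ^ e σ))
            * dW lo Λ c ν n t ℓ * ‖fc v ℓ‖ := by
  intro k W M hM c hc Φ lo hi Λ β σ C ν₀ K hlo hlo1 hhi hΛ hβ hσ hC hν₀ hν₀1 hK hV hHfam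
  obtain ⟨C₁, hCC₁, hmain⟩ := ssMode_grid e he k W M hM c hc Φ lo hi Λ β σ C ν₀ K hlo hlo1 hhi hΛ hβ hσ hC hν₀ hν₀1 hK hV hHfam
  refine ⟨C₁, hCC₁, ?_⟩
  intro ν hν n hn 𝔸 hodd hwin hΦo hΦw Tw hTw U T hU hT t ht htT ℓ hℓ v hv hvs
  have h := hmain ν hν n hn 𝔸 hodd hwin hΦo hΦw Tw hTw U T hU hT 0 t le_rfl ht htT ⟨0, by simp⟩ ℓ hℓ v hv hvs
  simpa only [sub_zero] using h

end Summit.AnomalousDissipation.AnomalousDissipation.Theorems.SolenoidalFractalHomogenisation.LagrangianStep.VmodGen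

end
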